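import Summits.Ventures.HSemireg.WedgeHankelRecurrenceGaussChebyshevOddFactorialIdentities

/-!
# Venture HSemireg — **TANGENT-LINE LOWER BOUNDS AT THE ENDPOINT: `S_n(x) ≥ (n+1) + C(n+2,3)(x−2)` and `C_{n+1}(x) ≥ 2 + (n+1)²(x−2)` for `x ≥ 2`; `U_n(x) ≥ (n+1) + 2C(n+2,3)(x−1)` and
# `T_n(x) ≥ 1 + n²(x−1)` for `x ≥ 1`** (the first two Taylor terms at the endpoint, N549; all later terms are `≥ 0` there — sharpening the constant bounds `S_n ≥ n+1`, `C_n ≥ 2`, `U_n ≥ n+1`, `T_n ≥ 1` of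
# N521 ∕ Mathlib `one_le_eval_T_real` by the slope `P′(endpoint)`)

HONEST FRAMING. Part of the Lean index of the computation cell `pub-hsemireg` (seat p10 gen 49, Sunday typer «UNIFORM-IN-n»).  Real inequalities for polynomial functions (Mathlib `Polynomial.Chebyshev.T ∕ U ∕ C ∕ S`
over `ℝ`, `Nat.choose`, `Finset.sum`); no variety, no cohomology theory, no sheaf, no Ext group and no semiregularity map is constructed here; nothing here says that HC / HC_CM / HC_AV holds; no
Literature fact (unproved `Prop`) is declared or used.  Custodian versions as in `WedgeHankelSiegelIdeal` (1/3).
SOURCES (cited).  T. J. Rivlin, *The Chebyshev Polynomials* (Wiley 1974), §1.2, (1.97)–(1.98) (`T_n′(1) = n²`, `U_n′(1) = n(n+1)(n+2)∕3 = 2C(n+2,3)`) and §2.7 (growth outside the interval); P. Borwein,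
T. Erdélyi, *Polynomials and Polynomial Inequalities* (Springer 1995), §5.1.
PROOF TYPED HERE.  N549 `chebyshevS_eval_add_two ∕ chebyshevC_eval_add_two` write `P(x) = Σ_k c_k (x−2)^k` with `c_k ≥ 0`; keep the terms `k = 0, 1` (`Finset.sum_le_sum_of_subset_of_nonneg` on
`range 2 ⊆ range N`); `C(n+2,2) + C(n+1,2) = (n+1)²` (`Nat.cast_choose_two`); `T_n(x) = ½C_n(2x)`, `U_n(x) = S_n(2x)` (N548 `chebyshevC_eval_two_mul`, N521 `chebyshevS_eval_eq_U_eval_half`).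
DEDUP DISCLOSURE (`rg -n '\\* \\(x - 1\\) ≤|\\* \\(x - 2\\) ≤|choose 3' Summits/Ventures/HSemireg Literature/Algebra/Polynomial Literature/Analysis/Approximation Mathlib…Chebyshev`, 2026-09-05): only the CONSTANT
lower bounds (N521 `le_eval_chebyshevU_real`, `le_eval_chebyshevS_real`, `two_le_eval_chebyshevC_real`; Mathlib `one_le_eval_T_real`) and the power comparisons of N532; no tangent-line bound in Mathlib or
the tree; 0 hits for the 6 names below.

WHAT IS IN THE TREE.  N549 `chebyshevS_eval_add_two`, `chebyshevC_eval_add_two`; N548 `chebyshevC_eval_two_mul`; N521 `chebyshevS_eval_eq_U_eval_half`; Mathlib `Finset.sum_le_sum_of_subset_of_nonneg`,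
`Finset.range_subset_range`, `Nat.cast_choose_two`, `Nat.choose_one_right`.
THIS FILE (namespace `Summit.Ventures.HSemireg.Wedge.HankelOuter` continued; CHAINED on N554; 0 definitions):
* §1320 `add_le_sum_range_of_nonneg` (`f 0 + f 1 ≤ Σ_{k<N} f k` for `f ≥ 0`, `N ≥ 2`), `cast_choose_two_add_choose_two` (`C(n+2,2) + C(n+1,2) = (n+1)²` in `ℝ`), **`chebyshevS_real_tangent_le`**,
  **`chebyshevC_real_tangent_le`**, **`chebyshevU_real_tangent_le`**, **`chebyshevT_real_tangent_le`** (statements as in the title).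
CAVEATS.  `n ∈ ℕ`; the `C`-bound is indexed `n + 1` (`C_0 = 2` is constant); the `T`-bound holds for all `n ∈ ℕ`.  Nothing Ext-side.  New names only.
-/

open Module Polynomial
open scoped Matrix Polynomial

namespace Summit.Ventures.HSemireg.Wedge.HankelOuter

/-! ## §1320. Tangent-line lower bounds at the endpoint -/

/-- `f 0 + f 1 ≤ Σ_{k<N} f k` for a nonnegative `f` and `N ≥ 2`. [this file, §1320] -/
theorem add_le_sum_range_of_nonneg {f : ℕ → ℝ} (hf : ∀ k, 0 ≤ f k) {N : ℕ} (hN : 2 ≤ N) : f 0 + f 1 ≤ ∑ k ∈ Finset.range N, f k := by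
  have h := Finset.sum_le_sum_of_subset_of_nonneg (f := f) (Finset.range_subset_range.mpr hN) (fun i _ _ => hf i)
  rw [Finset.sum_range_succ, Finset.sum_range_one] at h
  exact h

/-- `C(n+2, 2) + C(n+1, 2) = (n+1)²` (cast to `ℝ`). [this file, §1320] -/
theorem cast_choose_two_add_choose_two (n : ℕ) : ((n + 2).choose 2 : ℝ) + ((n + 1).choose 2 : ℝ) = ((n : ℝ) + 1) ^ 2 := by
  rw [Nat.cast_choose_two ℝ, Nat.cast_choose_two ℝ]
  push_cast
  ring

/-- **`(n+1) + C(n+2,3)·(x − 2) ≤ S_n(x)` for `x ≥ 2`** (tangent line at `2`: `S_n(2) = n+1`, `S_n′(2) = C(n+2,3)`). [Rivlin 1974, (1.98) (rescaled); this file, §1320] -/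
theorem chebyshevS_real_tangent_le (n : ℕ) {x : ℝ} (hx : 2 ≤ x) :
    ((n : ℝ) + 1) + ((n + 2).choose 3 : ℝ) * (x - 2) ≤ (Polynomial.Chebyshev.S ℝ (n : ℤ)).eval x := by
  have h := chebyshevS_eval_add_two (R := ℝ) n (x - 2)
  rw [sub_add_cancel] at h
  rw [h]
  rcases Nat.eq_zero_or_pos n with rfl | hn
  · simp
  · have hy : 0 ≤ x - 2 := by linarith
    have hf : ∀ k, 0 ≤ ((n + 1 + k).choose (2 * k + 1) : ℝ) * (x - 2) ^ k := fun k => by positivity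
    have h2 := add_le_sum_range_of_nonneg hf (N := n + 1) (by omega)
    have e0 : ((n + 1 + 0).choose (2 * 0 + 1) : ℝ) * (x - 2) ^ 0 = (n : ℝ) + 1 := by simp
    have e1 : ((n + 1 + 1).choose (2 * 1 + 1) : ℝ) * (x - 2) ^ 1 = ((n + 2).choose 3 : ℝ) * (x - 2) := by
      rw [pow_one, show n + 1 + 1 = n + 2 from rfl, show 2 * 1 + 1 = 3 from rfl]
    rw [e0, e1] at h2
    exact h2

/-- **`2 + (n+1)²·(x − 2) ≤ C_{n+1}(x)` for `x ≥ 2`** (tangent line at `2`: `C_m(2) = 2`, `C_m′(2) = m²`). [Rivlin 1974, (1.97) (rescaled); this file, §1320] -/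
theorem chebyshevC_real_tangent_le (n : ℕ) {x : ℝ} (hx : 2 ≤ x) :
    2 + ((n : ℝ) + 1) ^ 2 * (x - 2) ≤ (Polynomial.Chebyshev.C ℝ ((n + 1 : ℕ) : ℤ)).eval x := by
  have h := chebyshevC_eval_add_two (R := ℝ) n (x - 2)
  rw [sub_add_cancel] at h
  rw [h]
  have hy : 0 ≤ x - 2 := by linarith
  have hf : ∀ k, 0 ≤ ((n + 1 + k).choose (2 * k) + (n + k).choose (2 * k) : ℝ) * (x - 2) ^ k := fun k => by positivity
  have h2 := add_le_sum_range_of_nonneg hf (N := n + 2) (by omega)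
  have e0 : ((n + 1 + 0).choose (2 * 0) + (n + 0).choose (2 * 0) : ℝ) * (x - 2) ^ 0 = 2 := by norm_num
  have e1 : ((n + 1 + 1).choose (2 * 1) + (n + 1).choose (2 * 1) : ℝ) * (x - 2) ^ 1 = ((n : ℝ) + 1) ^ 2 * (x - 2) := by
    rw [pow_one, show n + 1 + 1 = n + 2 from rfl, show 2 * 1 = 2 from rfl, cast_choose_two_add_choose_two]
  rw [e0, e1] at h2
  exact h2

/-- **`(n+1) + 2C(n+2,3)·(x − 1) ≤ U_n(x)` for `x ≥ 1`** (tangent line at `1`: `U_n(1) = n+1`, `U_n′(1) = n(n+1)(n+2)∕3 = 2C(n+2,3)`). [Rivlin 1974, (1.98); this file, §1320] -/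
theorem chebyshevU_real_tangent_le (n : ℕ) {x : ℝ} (hx : 1 ≤ x) :
    ((n : ℝ) + 1) + 2 * ((n + 2).choose 3 : ℝ) * (x - 1) ≤ (Polynomial.Chebyshev.U ℝ (n : ℤ)).eval x := by
  have h := chebyshevS_real_tangent_le n (x := 2 * x) (by linarith)
  rw [chebyshevS_eval_eq_U_eval_half, show (2 : ℝ) * x / 2 = x by ring] at h
  linarith

/-- **`1 + n²·(x − 1) ≤ T_n(x)` for `x ≥ 1`** (tangent line at `1`: `T_n(1) = 1`, `T_n′(1) = n²`). [Rivlin 1974, (1.97); this file, §1320] -/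
theorem chebyshevT_real_tangent_le (n : ℕ) {x : ℝ} (hx : 1 ≤ x) :
    1 + (n : ℝ) ^ 2 * (x - 1) ≤ (Polynomial.Chebyshev.T ℝ (n : ℤ)).eval x := by
  match n with
  | 0 => simp
  | m + 1 =>
    have h := chebyshevC_real_tangent_le m (x := 2 * x) (by linarith)
    rw [chebyshevC_eval_two_mul] at h
    push_cast at h ⊢
    linarith

end Summit.Ventures.HSemireg.Wedge.HankelOuter
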